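import Summits.ABC.IUTFork.Joshi.Arithmeticoids2
import Summits.ABC.IUTFork.Joshi.ArithmeticoidsAddenda

/-!
# [J-2½] Thm. 5.12.1 (2), topological clause — DISCHARGED modulo print's valuation topology (arXiv:2305.10398 §5.12)

Block E proof-only file (cell abc-iut, rung LADDER-ABC:A2.E, seat abc-iut-E-t46; own-claim discharge). In `Joshi/Arithmeticoids2.lean` (p432942)
the clause «isomorphism of the TOPOLOGICAL monoids `L*_{1,v} ≃ L*_{2,v}`» of [J-2½] Thm. 5.12.1 (2) (p.40 l.14–18) was left as the claim-`Prop`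
`DeformationDatum.Thm5121_2_top`, because seat E-t37's signature `DeformationDatum` (p430482) carries the topology of the residue fields `K_y` as a
parameter unrelated to `|−|_{K_y}`. Seat E-t37 has since named that gap: `DeformationDatum.IsValuationTopology` (`Joshi/ArithmeticoidsAddenda.lean`
p433085: a set is open iff it contains a `|−|_{K_y}`-ball about each of its points — print's topology, §2.3 p.11 l.33 – p.12 l.6). Under exactly
that hypothesis the claim is a THEOREM (`thm5121_2_top_of_isValuationTopology`): the isomorphism `L_{1,v} ≃ L_v ≃ L_{2,v}` (`thm5121_2`) commutes
with the two untilt embeddings, and by the normalization law (5.3.3) (`absLv_eq_rpow`: `|x|_v = |ι_{y}(x)|^{α_v(y)}_{K_y}`) one has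
`|ι_{y₂}(d)|_{K₂} = (|ι_{y₁}(d)|^{α₁}_{K₁})^{1/α₂}`, so `|−|_{K₁}`-balls traced on `L_{1,v}` go to `|−|_{K₂}`-balls traced on `L_{2,v}`; the Bourbaki
constant `A` of §2.3 (`IsValuedField.exists_const`) is what makes the auxiliary set `U₁` open. No new `Prop`; nothing of E-t37's edited. TAKES NO
SIDE on [IUTchIII] Cor. 3.12, on Joshi's claims, or on Mochizuki's reports on them; typed ≠ proved for everything not derived here. [J-2½] = K. Joshi,
arXiv:2305.10398, bib `Joshi2023ATS2half`.
-/

noncomputable section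

open TopologicalSpace

namespace Summit.ABC.IUTFork.Joshi.ATS2h

namespace DeformationDatum

variable {L : Type} [Field L] {V : Type} {Lv : V → Type} [∀ v, Field (Lv v)] {Y : V → Type}
  [∀ v, TopologicalSpace (Y v)] {K : (v : V) → Y v → Type} [∀ v y, Field (K v y)] [∀ v y, TopologicalSpace (K v y)]
  {G : V → Type} [∀ v, Group (G v)] {A : V → Type} [∀ v, Group (A v)]
  (D : DeformationDatum L V Lv Y K G A)

/-- `L_v ≃ L_{i,v}` sends `x` to `ι_{y_v}(x)`. [folklore] -/
theorem embeddedLvEquiv_apply_coe (y : D.Arith) (v : V) (x : Lv v) :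
    ((D.embeddedLvEquiv y v x : D.embeddedLv y v) : K v (y v)) = D.emb v (y v) x := rfl

/-- The inverse `L_{i,v} ≃ L_v` sends `ι_{y_v}(x)` back to `x`. [folklore] -/
theorem embeddedLvEquiv_symm_apply_mk (y : D.Arith) (v : V) (x : Lv v) (h : D.emb v (y v) x ∈ D.embeddedLv y v) :
    (D.embeddedLvEquiv y v).symm ⟨D.emb v (y v) x, h⟩ = x := by
  have : (⟨D.emb v (y v) x, h⟩ : D.embeddedLv y v) = D.embeddedLvEquiv y v x := Subtype.ext rfl
  rw [this, RingEquiv.symm_apply_apply]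

/-- The isomorphism `L_{1,v} ≃ L_{2,v}` of Thm. 5.12.1 (2) commutes with the untilt embeddings: `ι_{y₁,v}(x) ↦ ι_{y₂,v}(x)`. [folklore] -/
theorem thm5121_2_apply_coe (y₁ y₂ : D.Arith) (v : V) (x : Lv v) (h : D.emb v (y₁ v) x ∈ D.embeddedLv y₁ v) :
    ((D.thm5121_2 y₁ y₂ v ⟨D.emb v (y₁ v) x, h⟩ : D.embeddedLv y₂ v) : K v (y₂ v)) = D.emb v (y₂ v) x := by
  simp only [thm5121_2, RingEquiv.coe_trans, Function.comp_apply, D.embeddedLvEquiv_symm_apply_mk]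
  rfl

/-- The normalization law (5.3.3) compares the two readings of `L_v`: `|ι_{y₂}(d)|_{K₂}^{α₂} = |ι_{y₁}(d)|_{K₁}^{α₁}` (both are `|d|_v`).
[claim: Joshi2023ATS2half, status: disputed] -/
theorem absK_emb_rpow_eq (y₁ y₂ : D.Arith) (v : V) (d : Lv v) :
    D.absK v (y₂ v) (D.emb v (y₂ v) d) ^ D.α v (y₂ v) = D.absK v (y₁ v) (D.emb v (y₁ v) d) ^ D.α v (y₁ v) := by
  rw [← D.absLv_eq_rpow v (y₂ v) d, ← D.absLv_eq_rpow v (y₁ v) d]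

/-- Hence `|ι_{y₂}(d)|_{K₂} = (|ι_{y₁}(d)|_{K₁}^{α₁})^{α₂⁻¹}`. [claim: Joshi2023ATS2half, status: disputed] -/
theorem absK_emb_eq_rpow_rpow (y₁ y₂ : D.Arith) (v : V) (d : Lv v) :
    D.absK v (y₂ v) (D.emb v (y₂ v) d) =
      (D.absK v (y₁ v) (D.emb v (y₁ v) d) ^ D.α v (y₁ v)) ^ (D.α v (y₂ v))⁻¹ := by
  rw [← D.absK_emb_rpow_eq y₁ y₂ v d,
    Real.rpow_rpow_inv ((D.absK_isValuedField v (y₂ v)).nonneg _) (D.α_pos v (y₂ v)).ne']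

/-- A map `L_{1,v} → L_{2,v}` commuting with the untilt embeddings is CONTINUOUS for the subspace topologies, provided the residue fields carry
their valuation topologies (E-t37's `IsValuationTopology`). The auxiliary open set is `U₁ = {z ∈ K₁ : some |−|_{K₁}-ball about z, traced on
L_{1,v}, maps into U₂}`; its openness uses the Bourbaki constant `A` of §2.3, the ball comparison uses (5.3.3). [folklore] -/
theorem continuous_of_comm_emb (hT : D.IsValuationTopology) {y₁ y₂ : D.Arith} {v : V}
    (g : D.embeddedLv y₁ v → D.embeddedLv y₂ v)
    (hg : ∀ (x : Lv v) (h : D.emb v (y₁ v) x ∈ D.embeddedLv y₁ v), (g ⟨D.emb v (y₁ v) x, h⟩ : K v (y₂ v)) = D.emb v (y₂ v) x) :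
    Continuous g := by
  rw [continuous_def]
  intro s hs
  obtain ⟨U₂, hU₂, rfl⟩ := isOpen_induced_iff.mp hs
  obtain ⟨A, hA, hAle⟩ := (D.absK_isValuedField v (y₁ v)).exists_const
  set U₁ : Set (K v (y₁ v)) :=
    {z | ∃ ε : ℝ, 0 < ε ∧ ∀ x' : Lv v, D.absK v (y₁ v) (D.emb v (y₁ v) x' - z) < ε → D.emb v (y₂ v) x' ∈ U₂} with hU₁def
  have hU₁ : IsOpen U₁ := by
    rw [hT v (y₁ v)]
    rintro z ⟨ε, hε, hz⟩
    refine ⟨ε / (2 * A), by positivity, ?_⟩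
    intro w hw
    refine ⟨ε / (2 * A), by positivity, fun x' hx' => hz x' ?_⟩
    have hw' : D.absK v (y₁ v) (w - z) < ε / (2 * A) := hw
    calc D.absK v (y₁ v) (D.emb v (y₁ v) x' - z)
        = D.absK v (y₁ v) ((D.emb v (y₁ v) x' - w) + (w - z)) := by rw [sub_add_sub_cancel]
      _ ≤ A * max (D.absK v (y₁ v) (D.emb v (y₁ v) x' - w)) (D.absK v (y₁ v) (w - z)) := hAle _ _
      _ < A * (ε / (2 * A)) := by gcongr; exact max_lt hx' hw'
      _ = ε / 2 := by field_simp
      _ < ε := by linarith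
  refine isOpen_induced_iff.mpr ⟨U₁, hU₁, ?_⟩
  ext ⟨z, hz⟩
  obtain ⟨x, rfl⟩ := RingHom.mem_range.mp hz
  simp only [Set.mem_preimage]
  rw [hg x hz]
  constructor
  · rintro ⟨ε, hε, h⟩
    exact h x (by rw [sub_self, ((D.absK_isValuedField v (y₁ v)).eq_zero_iff 0).2 rfl]; exact hε)
  · intro hxU
    obtain ⟨ε, hε, hball⟩ := (hT v (y₂ v) U₂).mp hU₂ _ hxU
    refine ⟨(ε ^ D.α v (y₂ v)) ^ (D.α v (y₁ v))⁻¹, by positivity, fun x' hx' => hball ?_⟩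
    show D.absK v (y₂ v) (D.emb v (y₂ v) x' - D.emb v (y₂ v) x) < ε
    rw [← map_sub] at hx' ⊢
    have h0 : 0 ≤ D.absK v (y₁ v) (D.emb v (y₁ v) (x' - x)) := (D.absK_isValuedField v (y₁ v)).nonneg _
    have h1 : D.absK v (y₁ v) (D.emb v (y₁ v) (x' - x)) ^ D.α v (y₁ v) < ε ^ D.α v (y₂ v) := by
      calc D.absK v (y₁ v) (D.emb v (y₁ v) (x' - x)) ^ D.α v (y₁ v)
          < ((ε ^ D.α v (y₂ v)) ^ (D.α v (y₁ v))⁻¹) ^ D.α v (y₁ v) := Real.rpow_lt_rpow h0 hx' (D.α_pos v (y₁ v))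
        _ = ε ^ D.α v (y₂ v) := Real.rpow_inv_rpow (by positivity) (D.α_pos v (y₁ v)).ne'
    rw [D.absK_emb_eq_rpow_rpow y₁ y₂ v (x' - x)]
    calc (D.absK v (y₁ v) (D.emb v (y₁ v) (x' - x)) ^ D.α v (y₁ v)) ^ (D.α v (y₂ v))⁻¹
        < (ε ^ D.α v (y₂ v)) ^ (D.α v (y₂ v))⁻¹ :=
          Real.rpow_lt_rpow (Real.rpow_nonneg h0 _) h1 (inv_pos.2 (D.α_pos v (y₂ v)))
      _ = ε := Real.rpow_rpow_inv hε.le (D.α_pos v (y₂ v)).ne'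

/-- **[J-2½] Thm. 5.12.1 (2), topological clause, DISCHARGED modulo the valuation topology** (p.40 l.14–18: «an isomorphism of the
topological monoids `L*_{1,v} ≃ L*_{2,v}`»): if the residue fields carry their valuation topologies (E-t37's `IsValuationTopology`, print's §2.3
topology), the ring isomorphism `thm5121_2 : L_{1,v} ≃ L_{2,v}` of p432942 is a homeomorphism for the subspace topologies — so `Thm5121_2_top`
holds. [claim: Joshi2023ATS2half, status: disputed] -/
theorem thm5121_2_top_of_isValuationTopology (hT : D.IsValuationTopology) : D.Thm5121_2_top := fun y₁ y₂ v =>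
  ⟨D.thm5121_2 y₁ y₂ v,
    D.continuous_of_comm_emb hT _ (D.thm5121_2_apply_coe y₁ y₂ v),
    D.continuous_of_comm_emb hT _ fun x h => by
      have h₁ : D.emb v (y₁ v) x ∈ D.embeddedLv y₁ v := RingHom.mem_range.mpr ⟨x, rfl⟩
      have hx : (D.thm5121_2 y₁ y₂ v).symm ⟨D.emb v (y₂ v) x, h⟩ = ⟨D.emb v (y₁ v) x, h₁⟩ := by
        apply (D.thm5121_2 y₁ y₂ v).injective
        rw [RingEquiv.apply_symm_apply]
        exact (Subtype.ext (D.thm5121_2_apply_coe y₁ y₂ v x h₁)).symm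
      rw [hx]⟩

end DeformationDatum

end Summit.ABC.IUTFork.Joshi.ATS2h
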